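import Summits.KontsevichZagierPeriods.KontsevichZagierPeriods.Theorems.HyperbolicBlochIsometryMove
import Summits.KontsevichZagierPeriods.KontsevichZagierPeriods.Theorems.HyperbolicBlochOffTetraSectorKernelStubConeAbsorptionTwoAux
import Summits.KontsevichZagierPeriods.KontsevichZagierPeriods.Theorems.HyperbolicBlochOffTetraSectorKernelStubSpxSemialgebraic
import Summits.KontsevichZagierPeriods.KontsevichZagierPeriods.Theorems.HyperbolicBlochOffTetraSectorKernelStubSpxCovariance
import Summits.KontsevichZagierPeriods.KontsevichZagierPeriods.Theorems.HyperbolicBlochOffTetraSectorKernelStubSpxSplit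
import Summits.KontsevichZagierPeriods.KontsevichZagierPeriods.Theorems.HyperbolicBlochOffTetraSectorKernelStubIdealSpxClass
import Literature.NumberTheory.Transcendental.KZSemiCanonicalReductionProofs

/-!
# `OffTetraSectorKernel` (stmt-KontsevichZagierPeriods-10557) — line `odd-hyperbolic-ladder` (skeleton v3),
stub `stub_coneAbsorptionTwo`: the lune argument at the normalised apex

Lead c2. Dupont–Sah's elementary argument that ideal simplices generate the scissors congruence group of
`H̄³` up to 2-torsion (J. Pure Appl. Algebra 25 (1982), §3), INSIDE the Kontsevich–Zagier calculus, in the paraboloid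
lift of the landed `FiveTermTransfer` (`Ql p = (|p|², p₀, p₁, 1)`, open simplex `Spx v` of four lifted rows). For a
cone with apex `(0,0,1)` (row `(1,0,0,1)`) and three algebraic ideal rows `n`:

* `coneMain_lune_step` — ONE LUNE: the apex lies on the geodesic from the ideal vertex `n j` to its antipode
  `M₀ (n j)` (`(1,0,0,1) = (n j + M₀ n j)/(n j 0 + n j 3)`), so the IDEAL simplex with the apex replaced by the antipode
  splits (landed `stub_spxSplit`, one rule-(1a) instance via `KZ.of_sub_sum_of_mem_relations`) into the cone and the
  cone with `n j` replaced by its antipode; the ideal piece is `±[ρ z]` (landed `stub_idealSpxClass`);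
* `coneMain_reflect_equivalent` — the cone with all three ideal vertices replaced by their antipodes is the image of the
  cone under the point reflection through `(0,0,1)` = unit inversion (with `y`-flip) followed by `(x,y,t) ↦ (−x,y,t)`
  (landed `IsometryMove.inversion_transport`, `IsometryMove.simil_transport`; image identified by the landed
  `stub_spxCovariance` with `M₀`, factor `1/|p|²`), hence KZ-equivalent to it;
* `coneMain_absorption_normalised` (registered sub-goal) — three lunes and the reflection:
  `2·[C] ≡ [I₁] − [I₂] + [I₃] ≡ ε₁[ρ z₁] − ε₂[ρ z₂] + ε₃[ρ z₃]`.

The general apex is reduced to this one in `…StubConeAbsorptionTwo.lean` by a boundary similarity.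
-/

noncomputable section

open Set MeasureTheory
open Literature.NumberTheory.Transcendental

namespace Summit.KontsevichZagierPeriods.HyperbolicBloch.OffTetraSectorKernel

/-! ### The lune step -/

/-- `Matrix.of (update v i x)` is `updateRow`. [folklore] -/
theorem coneMain_of_update_eq (v : Fin 4 → Fin 4 → ℝ) (i : Fin 4) (x : Fin 4 → ℝ) :
    Matrix.of (Function.update v i x) = (Matrix.of v).updateRow i x := rfl

/-- One LUNE through the apex: extending the edge from the ideal vertex `n j` through the apex `(0,0,1)` to its
antipode `M₀ (n j)` splits the ideal simplex `W` (apex row replaced by the antipode) into the cone and the cone with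
`n j` replaced by its antipode. Output: the ideal representation `R`, a representation `rc` on the cone, the
restricted representation `r'` on the second cone, the dissection relation for every representation of the cone, the
class of `R`, and the data needed to iterate. -/
theorem coneMain_lune_step (Ql : (Fin 3 → ℝ) → Fin 4 → ℝ) (hQl : ∀ p, Ql p = ![p 0 ^ 2 + p 1 ^ 2 + p 2 ^ 2, p 0, p 1, 1])
    (Spx : (Fin 4 → Fin 4 → ℝ) → Set (Fin 3 → ℝ))
    (hSpx : ∀ v, Spx v = {p | 0 < p 2 ∧ ∀ a, 0 < (Matrix.of v).det * ((Matrix.of v).updateRow a (Ql p)).det})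
    (M₀ : Matrix (Fin 4) (Fin 4) ℝ) (hM₀ : M₀ = !![0, 0, 0, 1; 0, -1, 0, 0; 0, 0, -1, 0; 1, 0, 0, 0])
    (ρ : ℂ → KZ.IntegralRep 3)
    (hρ : ∀ z, IsAlgebraic ℚ z → 0 < z.im →
      (ρ z).domain = idealTetrahedron z ∧ EqOn (ρ z).integrand (fun p => 1 / p 2 ^ 3) (idealTetrahedron z))
    (n : Fin 3 → Fin 4 → ℝ) (hn : ∀ i j, IsAlgebraic ℚ (n i j)) (hnull : ∀ i, (fun x : Fin 4 → ℝ => x 1 ^ 2 + x 2 ^ 2 = x 0 * x 3 ∧ 0 ≤ x 3 ∧ 0 < x 0 + x 3) (n i))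
    (hdet : (Matrix.of (Matrix.vecCons ![(1 : ℝ), 0, 0, 1] n)).det ≠ 0) (j : Fin 3) :
    ∃ (R rc r' : KZ.IntegralRep 3),
      rc.domain = Spx (Matrix.vecCons ![(1 : ℝ), 0, 0, 1] n) ∧ EqOn rc.integrand (fun p => 1 / p 2 ^ 3) rc.domain ∧
      r'.domain = Spx (Matrix.vecCons ![(1 : ℝ), 0, 0, 1] (Function.update n j (M₀.mulVec (n j)))) ∧
      EqOn r'.integrand (fun p => 1 / p 2 ^ 3) r'.domain ∧
      (∀ r : KZ.IntegralRep 3, r.domain = Spx (Matrix.vecCons ![(1 : ℝ), 0, 0, 1] n) →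
        EqOn r.integrand (fun p => 1 / p 2 ^ 3) r.domain → KZ.of R - KZ.of r - KZ.of r' ∈ KZ.relations) ∧
      (∃ (z : ℂ) (ε : ℤ), IsAlgebraic ℚ z ∧ 0 < z.im ∧ (ε = 1 ∨ ε = -1) ∧ KZ.of R - ε • KZ.of (ρ z) ∈ KZ.relations) ∧
      (∀ i k, IsAlgebraic ℚ (Function.update n j (M₀.mulVec (n j)) i k)) ∧
      (∀ i, (fun x : Fin 4 → ℝ => x 1 ^ 2 + x 2 ^ 2 = x 0 * x 3 ∧ 0 ≤ x 3 ∧ 0 < x 0 + x 3) (Function.update n j (M₀.mulVec (n j)) i)) ∧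
      (Matrix.of (Matrix.vecCons ![(1 : ℝ), 0, 0, 1] (Function.update n j (M₀.mulVec (n j))))).det ≠ 0 := by
  classical
  -- notation
  set u : Fin 4 → ℝ := M₀.mulVec (n j) with hu
  set v : Fin 4 → Fin 4 → ℝ := Matrix.vecCons ![(1 : ℝ), 0, 0, 1] n with hv
  set s : ℝ := n j 0 + n j 3 with hs
  have hspos : 0 < s := (hnull j).2.2
  set α : ℝ := s⁻¹ with hα
  have hαpos : 0 < α := inv_pos.mpr hspos
  have hvi : v j.succ = n j := by simp [hv]
  have hv0 : v 0 = ![(1 : ℝ), 0, 0, 1] := by simp [hv]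
  have hu' : u = ![n j 3, -n j 1, -n j 2, n j 0] := by rw [hu, coneAux_M₀_mulVec M₀ hM₀]
  -- the apex lies on the geodesic from `n j` to its antipode
  have hcomb : v 0 = α • v j.succ + α • u := by
    rw [hv0, hvi, hu']
    ext k
    fin_cases k <;> simp [hα] <;> field_simp <;> ring
  -- the ideal simplex `W` and the second cone `V'`
  set W : Fin 4 → Fin 4 → ℝ := Function.update v 0 u with hW
  set V' : Fin 4 → Fin 4 → ℝ := Function.update v j.succ u with hV'
  have hV'cons : V' = Matrix.vecCons ![(1 : ℝ), 0, 0, 1] (Function.update n j u) := by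
    rw [hV', hv]
    exact (Fin.cons_update (α := fun _ => Fin 4 → ℝ) ![(1 : ℝ), 0, 0, 1] n j u).symm
  -- splitting
  obtain ⟨hsub₁, hsub₂, hdisj, hnull0⟩ := stub_spxSplit Ql hQl Spx hSpx v j.succ u α α
    (Fin.succ_ne_zero j) hαpos hαpos hcomb hdet
  -- determinants
  have hdetW : (Matrix.of W).det = s * (Matrix.of v).det := by
    have e : (Matrix.of v).det = α * ((Matrix.of v).updateRow 0 (Matrix.of v j.succ)).det +
        α * ((Matrix.of v).updateRow 0 u).det := by
      conv_lhs => rw [← Matrix.updateRow_eq_self (Matrix.of v) 0]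
      rw [show (Matrix.of v) 0 = α • Matrix.of v j.succ + α • u from hcomb, Matrix.det_updateRow_add,
        Matrix.det_updateRow_smul, Matrix.det_updateRow_smul]
    have z : ((Matrix.of v).updateRow 0 (Matrix.of v j.succ)).det = 0 := by
      refine Matrix.det_zero_of_row_eq (i := 0) (j := j.succ) (Fin.succ_ne_zero j).symm ?_
      simp [Matrix.updateRow_self]
    rw [z, mul_zero, zero_add] at e
    rw [hW, coneMain_of_update_eq, e, hα]
    field_simp
  have hdetW0 : (Matrix.of W).det ≠ 0 := by
    rw [hdetW]; exact mul_ne_zero hspos.ne' hdet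
  have hdetV' : (Matrix.of V').det = -(Matrix.of v).det := by
    have hu2 : u = s • Matrix.of v 0 + (-1 : ℝ) • Matrix.of v j.succ := by
      rw [show Matrix.of v 0 = v 0 from rfl, hcomb]
      ext k
      simp [hα, smul_eq_mul]
      field_simp
      ring
    rw [hV', coneMain_of_update_eq, hu2, Matrix.det_updateRow_add, Matrix.det_updateRow_smul,
      Matrix.det_updateRow_smul]
    have z : ((Matrix.of v).updateRow j.succ (Matrix.of v 0)).det = 0 := by
      refine Matrix.det_zero_of_row_eq (i := j.succ) (j := 0) (Fin.succ_ne_zero j) ?_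
      simp [Matrix.updateRow_self, Matrix.updateRow_ne (Fin.succ_ne_zero j).symm]
    rw [z, Matrix.updateRow_eq_self]
    ring
  have hdetV'0 : (Matrix.of V').det ≠ 0 := by rw [hdetV']; exact neg_ne_zero.mpr hdet
  -- algebraicity and nullity of the new rows
  have hualg : ∀ k, IsAlgebraic ℚ (u k) := by
    intro k
    rw [hu']
    fin_cases k
    · simpa using hn j 3
    · simpa using (hn j 1).neg
    · simpa using (hn j 2).neg
    · simpa using hn j 0
  have hunull : (u 1 ^ 2 + u 2 ^ 2 = u 0 * u 3 ∧ 0 ≤ u 3 ∧ 0 < u 0 + u 3) := coneAux_null_M₀ M₀ hM₀ (hnull j)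
  have hm₀alg : ∀ k, IsAlgebraic ℚ ((![(1 : ℝ), 0, 0, 1] : Fin 4 → ℝ) k) := by
    intro k; fin_cases k <;> simp <;> first | exact isAlgebraic_one | exact isAlgebraic_zero
  have hWalg : ∀ i k, IsAlgebraic ℚ (W i k) := by
    intro i k
    rw [hW]
    rcases eq_or_ne i 0 with rfl | hi
    · simpa using hualg k
    · rw [Function.update_of_ne hi]
      obtain ⟨l, rfl⟩ := Fin.exists_succ_eq.mpr hi
      simpa [hv] using hn l k
  have hWnull : ∀ i, (fun x : Fin 4 → ℝ => x 1 ^ 2 + x 2 ^ 2 = x 0 * x 3 ∧ 0 ≤ x 3 ∧ 0 < x 0 + x 3) (W i) := by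
    intro i
    rw [hW]
    rcases eq_or_ne i 0 with rfl | hi
    · simpa using hunull
    · rw [Function.update_of_ne hi]
      obtain ⟨l, rfl⟩ := Fin.exists_succ_eq.mpr hi
      simpa [hv] using hnull l
  have hn'alg : ∀ i k, IsAlgebraic ℚ (Function.update n j u i k) := by
    intro i k
    rcases eq_or_ne i j with rfl | hi
    · simpa using hualg k
    · rw [Function.update_of_ne hi]; exact hn i k
  have hn'null : ∀ i, (fun x : Fin 4 → ℝ => x 1 ^ 2 + x 2 ^ 2 = x 0 * x 3 ∧ 0 ≤ x 3 ∧ 0 < x 0 + x 3) (Function.update n j u i) := by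
    intro i
    rcases eq_or_ne i j with rfl | hi
    · simpa using hunull
    · rw [Function.update_of_ne hi]; exact hnull i
  -- the ideal representation and its class
  obtain ⟨⟨R, hRdom, hRint⟩, hclass⟩ := stub_idealSpxClass Ql hQl Spx hSpx
    (stub_spxCovariance Ql hQl Spx hSpx) ρ hρ W hWalg hWnull hdetW0
  -- the two cones, by restriction
  have hvalg : ∀ i k, IsAlgebraic ℚ (v i k) := by
    intro i k
    rw [hv]
    refine Fin.cases ?_ (fun l => ?_) i
    · simpa using hm₀alg k
    · simpa using hn l k
  have hV'alg : ∀ i k, IsAlgebraic ℚ (V' i k) := by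
    intro i k
    rw [hV'cons]
    refine Fin.cases ?_ (fun l => ?_) i
    · simpa using hm₀alg k
    · simpa using hn'alg l k
  have hsa : Literature.ModelTheory.ExponentialFields.IsSemialgebraic ℚ (Spx V') :=
    stub_spxSemialgebraic Ql hQl Spx hSpx V' hV'alg
  have hsav : Literature.ModelTheory.ExponentialFields.IsSemialgebraic ℚ (Spx v) :=
    stub_spxSemialgebraic Ql hQl Spx hSpx v hvalg
  have hsubR : Spx V' ⊆ R.domain := by rw [hRdom]; exact hsub₂
  have hsubRv : Spx v ⊆ R.domain := by rw [hRdom]; exact hsub₁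
  set r' : KZ.IntegralRep 3 := R.restrict (Spx V') hsa hsubR with hr'
  set rc : KZ.IntegralRep 3 := R.restrict (Spx v) hsav hsubRv with hrc
  -- the dissection relation `[R] - [r] - [r'] ∈ relations`
  have hrel : ∀ r : KZ.IntegralRep 3, r.domain = Spx v → EqOn r.integrand (fun p => 1 / p 2 ^ 3) r.domain →
      KZ.of R - KZ.of r - KZ.of r' ∈ KZ.relations := by
    intro r hr hri
    have key := KZ.of_sub_sum_of_mem_relations (Finset.univ : Finset (Fin 2)) R ![r, r'] ?_ ?_ ?_ ?_
    · simpa [Fin.sum_univ_two, sub_sub] using key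
    · intro i _
      fin_cases i
      · show volume (r.domain \ R.domain) = 0
        rw [hr, hRdom, Set.sdiff_eq_empty.mpr hsub₁, measure_empty]
      · show volume (r'.domain \ R.domain) = 0
        rw [show r'.domain = Spx V' from rfl, hRdom, Set.sdiff_eq_empty.mpr hsub₂, measure_empty]
    · intro i _
      fin_cases i
      · show EqOn r.integrand R.integrand (r.domain ∩ R.domain)
        intro p hp
        rw [hri hp.1, hRint hp.2]
      · show EqOn r'.integrand R.integrand (r'.domain ∩ R.domain)
        intro p _
        rfl
    · have hU : (⋃ i ∈ (Finset.univ : Finset (Fin 2)), (![r, r'] i).domain) = r.domain ∪ r'.domain := by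
        ext p
        simp only [Finset.mem_univ, iUnion_true, mem_iUnion, mem_union]
        constructor
        · rintro ⟨i, hi⟩
          fin_cases i
          · exact Or.inl hi
          · exact Or.inr hi
        · rintro (h | h)
          · exact ⟨0, h⟩
          · exact ⟨1, h⟩
      rw [hU, hRdom, hr]
      exact hnull0
    · intro i _ k _ hik
      fin_cases i <;> fin_cases k
      · exact absurd rfl hik
      · show volume (r.domain ∩ r'.domain) = 0
        rw [hr, show r'.domain = Spx V' from rfl, hdisj.inter_eq, measure_empty]
      · show volume (r'.domain ∩ r.domain) = 0
        rw [hr, show r'.domain = Spx V' from rfl, inter_comm, hdisj.inter_eq, measure_empty]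
      · exact absurd rfl hik
  refine ⟨R, rc, r', rfl, fun p hp => hRint (hsubRv hp), ?_, fun p hp => hRint (hsubR hp), hrel,
    hclass R hRdom hRint, hn'alg, hn'null, ?_⟩
  · rw [show r'.domain = Spx V' from rfl, hV'cons]
  · rw [← hV'cons]; exact hdetV'0

/-! ### The point reflection through `(0,0,1)` as two landed moves -/

/-- The reflected cone is KZ-equivalent to the cone: `σ₀ = S' ∘ J` (unit inversion with `y`-flip, then the similarity
`(x,y,t) ↦ (-x,y,t)`), transported by `IsometryMove.inversion_transport` and `IsometryMove.simil_transport`, the image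
identified by `stub_spxCovariance`. -/
theorem coneMain_reflect_equivalent (Ql : (Fin 3 → ℝ) → Fin 4 → ℝ) (hQl : ∀ p, Ql p = ![p 0 ^ 2 + p 1 ^ 2 + p 2 ^ 2, p 0, p 1, 1])
    (Spx : (Fin 4 → Fin 4 → ℝ) → Set (Fin 3 → ℝ))
    (hSpx : ∀ v, Spx v = {p | 0 < p 2 ∧ ∀ a, 0 < (Matrix.of v).det * ((Matrix.of v).updateRow a (Ql p)).det})
    (M₀ : Matrix (Fin 4) (Fin 4) ℝ) (hM₀ : M₀ = !![0, 0, 0, 1; 0, -1, 0, 0; 0, 0, -1, 0; 1, 0, 0, 0])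
    (n : Fin 3 → Fin 4 → ℝ)
    (r r₃ : KZ.IntegralRep 3) (hr : r.domain = Spx (Matrix.vecCons ![(1 : ℝ), 0, 0, 1] n))
    (hri : EqOn r.integrand (fun p => 1 / p 2 ^ 3) r.domain)
    (hr₃ : r₃.domain = Spx (Matrix.vecCons ![(1 : ℝ), 0, 0, 1] fun i => M₀.mulVec (n i)))
    (hr₃i : EqOn r₃.integrand (fun p => 1 / p 2 ^ 3) r₃.domain) :
    KZ.of r - KZ.of r₃ ∈ KZ.relations := by
  classical
  -- the two maps, pinned by equations
  obtain ⟨J, hJ⟩ : ∃ J : (Fin 3 → ℝ) → (Fin 3 → ℝ), ∀ p, J p = ![p 0 / (p 0 ^ 2 + p 1 ^ 2 + p 2 ^ 2),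
      -p 1 / (p 0 ^ 2 + p 1 ^ 2 + p 2 ^ 2), p 2 / (p 0 ^ 2 + p 1 ^ 2 + p 2 ^ 2)] := ⟨_, fun _ => rfl⟩
  obtain ⟨S, hS⟩ : ∃ S : (Fin 3 → ℝ) → (Fin 3 → ℝ), ∀ p, S p = ![((-1 : ℂ) * (Complex.mk (p 0) ((-1) * p 1)) + 0).re,
      ((-1 : ℂ) * (Complex.mk (p 0) ((-1) * p 1)) + 0).im, ‖(-1 : ℂ)‖ * p 2] := ⟨_, fun _ => rfl⟩
  have hS' : ∀ p, S p = ![-p 0, p 1, p 2] := by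
    intro p; rw [hS]; ext i; fin_cases i <;> simp
  have hσ : ∀ p, S (J p) = ![-p 0 / (p 0 ^ 2 + p 1 ^ 2 + p 2 ^ 2), -p 1 / (p 0 ^ 2 + p 1 ^ 2 + p 2 ^ 2),
      p 2 / (p 0 ^ 2 + p 1 ^ 2 + p 2 ^ 2)] := by
    intro p; rw [hS', hJ]; ext i; fin_cases i <;> simp [neg_div]
  -- covariance: the image of the cone under `S ∘ J`
  have hcov := stub_spxCovariance Ql hQl Spx hSpx (fun p => S (J p)) M₀
    (fun p => (p 0 ^ 2 + p 1 ^ 2 + p 2 ^ 2)⁻¹) (by rw [coneAux_det_M₀ M₀ hM₀]; norm_num) ?_ ?_ (Matrix.vecCons ![(1 : ℝ), 0, 0, 1] n)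
  rotate_left
  · intro p hp
    have hN : 0 < p 0 ^ 2 + p 1 ^ 2 + p 2 ^ 2 := by positivity
    refine ⟨inv_pos.mpr hN, ?_, ?_⟩
    · show 0 < S (J p) 2
      rw [hσ]; simpa using div_pos hp hN
    · show Ql (S (J p)) = _
      rw [hσ]; exact coneAux_lift_antipode Ql hQl M₀ hM₀ p hp
  · intro p' hp'
    have hN : 0 < p' 0 ^ 2 + p' 1 ^ 2 + p' 2 ^ 2 := by positivity
    refine ⟨S (J p'), ?_, ?_⟩
    · rw [hσ]; simpa using div_pos hp' hN
    · show S (J (S (J p'))) = p'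
      rw [hσ p', hσ]
      have hN0 : p' 0 ^ 2 + p' 1 ^ 2 + p' 2 ^ 2 ≠ 0 := hN.ne'
      have e : (-p' 0 / (p' 0 ^ 2 + p' 1 ^ 2 + p' 2 ^ 2)) ^ 2 + (-p' 1 / (p' 0 ^ 2 + p' 1 ^ 2 + p' 2 ^ 2)) ^ 2 +
          (p' 2 / (p' 0 ^ 2 + p' 1 ^ 2 + p' 2 ^ 2)) ^ 2 = (p' 0 ^ 2 + p' 1 ^ 2 + p' 2 ^ 2)⁻¹ := by
        field_simp
      ext i
      fin_cases i
      · simp [e]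
        field_simp
      · simp [e]
        field_simp
      · simp [e]
        field_simp
  have himage : (fun p => S (J p)) '' Spx (Matrix.vecCons ![(1 : ℝ), 0, 0, 1] n) = Spx (Matrix.vecCons ![(1 : ℝ), 0, 0, 1] fun i => M₀.mulVec (n i)) := by
    rw [hcov]
    congr 1
    funext i
    refine Fin.cases ?_ (fun l => ?_) i
    · simp [coneAux_M₀_mulVec_apex M₀ hM₀]
    · simp
  -- transports
  have hσr : r.domain ⊆ {p | 0 < p 2} := by rw [hr]; exact (fun p hp => by rw [hSpx] at hp; exact hp.1)
  obtain ⟨⟨rJ, hrJd, hrJi⟩, _⟩ := IsometryMove.inversion_transport J hJ r hσr hri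
  have hmoveJ := (IsometryMove.inversion_transport J hJ r hσr hri).2 rJ hrJd hrJi
  have hσJ : rJ.domain ⊆ {p | 0 < p 2} := by
    rw [hrJd]; exact IsometryMove.inversion_image_subset J hJ hσr
  have halg1 : IsAlgebraic ℚ (-1 : ℂ) := isAlgebraic_one.neg
  obtain ⟨_, hmoveS⟩ := IsometryMove.simil_transport (α := -1) (β := 0) (η := -1) halg1 isAlgebraic_zero
    (by norm_num) (Or.inr rfl) S hS rJ hσJ hrJi
  have hdom₃ : r₃.domain = S '' rJ.domain := by
    rw [hr₃, hrJd, Set.image_image, ← himage, hr]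
  have h2 : KZ.Equivalent rJ r₃ := hmoveS r₃ hdom₃ hr₃i
  exact KZ.Equivalent.trans hmoveJ h2

/-! ### Three lunes and the reflection: twice the cone class -/

/-- At the normalised apex `(0,0,1)`: a representation on the cone exists, and twice its class is a combination of
three standard tetrahedra. -/
theorem coneMain_absorption_normalised :
    ∀ (Ql : (Fin 3 → ℝ) → Fin 4 → ℝ), (∀ p, Ql p = ![p 0 ^ 2 + p 1 ^ 2 + p 2 ^ 2, p 0, p 1, 1]) →
    ∀ (Spx : (Fin 4 → Fin 4 → ℝ) → Set (Fin 3 → ℝ)),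
      (∀ v, Spx v = {p | 0 < p 2 ∧ ∀ a, 0 < (Matrix.of v).det * ((Matrix.of v).updateRow a (Ql p)).det}) →
    ∀ (M₀ : Matrix (Fin 4) (Fin 4) ℝ), M₀ = !![0, 0, 0, 1; 0, -1, 0, 0; 0, 0, -1, 0; 1, 0, 0, 0] →
    ∀ (ρ : ℂ → KZ.IntegralRep 3),
      (∀ z, IsAlgebraic ℚ z → 0 < z.im →
        (ρ z).domain = idealTetrahedron z ∧ EqOn (ρ z).integrand (fun p => 1 / p 2 ^ 3) (idealTetrahedron z)) →
    ∀ (n : Fin 3 → Fin 4 → ℝ), (∀ i j, IsAlgebraic ℚ (n i j)) →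
      (∀ i, n i 1 ^ 2 + n i 2 ^ 2 = n i 0 * n i 3 ∧ 0 ≤ n i 3 ∧ 0 < n i 0 + n i 3) →
      (Matrix.of (Matrix.vecCons ![(1 : ℝ), 0, 0, 1] n)).det ≠ 0 →
      (∃ rc : KZ.IntegralRep 3, rc.domain = Spx (Matrix.vecCons ![(1 : ℝ), 0, 0, 1] n) ∧
        EqOn rc.integrand (fun p => 1 / p 2 ^ 3) rc.domain) ∧
      ∀ r : KZ.IntegralRep 3, r.domain = Spx (Matrix.vecCons ![(1 : ℝ), 0, 0, 1] n) →
        EqOn r.integrand (fun p => 1 / p 2 ^ 3) r.domain →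
        ∃ (z : Fin 3 → ℂ) (e : Fin 3 → ℤ), (∀ i, IsAlgebraic ℚ (z i)) ∧ (∀ i, 0 < (z i).im) ∧
          2 • KZ.of r - ∑ i, e i • KZ.of (ρ (z i)) ∈ KZ.relations := by
  intro Ql hQl Spx hSpx M₀ hM₀ ρ hρ n hn hnull hdet
  classical
  obtain ⟨R₁, rc, r₁, hrcd, hrci, hr₁d, hr₁i, hrel₁, ⟨z₁, ε₁, hz₁, hz₁i, -, hc₁⟩, hn₁a, hn₁n, hdet₁⟩ :=
    coneMain_lune_step Ql hQl Spx hSpx M₀ hM₀ ρ hρ n hn hnull hdet 0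
  set n₁ := Function.update n 0 (M₀.mulVec (n 0)) with hn₁
  obtain ⟨R₂, -, r₂, -, -, hr₂d, hr₂i, hrel₂, ⟨z₂, ε₂, hz₂, hz₂i, -, hc₂⟩, hn₂a, hn₂n, hdet₂⟩ :=
    coneMain_lune_step Ql hQl Spx hSpx M₀ hM₀ ρ hρ n₁ hn₁a hn₁n hdet₁ 1
  set n₂ := Function.update n₁ 1 (M₀.mulVec (n₁ 1)) with hn₂
  obtain ⟨R₃, -, r₃, -, -, hr₃d, hr₃i, hrel₃, ⟨z₃, ε₃, hz₃, hz₃i, -, hc₃⟩, -, -, -⟩ :=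
    coneMain_lune_step Ql hQl Spx hSpx M₀ hM₀ ρ hρ n₂ hn₂a hn₂n hdet₂ 2
  set n₃ := Function.update n₂ 2 (M₀.mulVec (n₂ 2)) with hn₃
  have hn₃eq : n₃ = fun i => M₀.mulVec (n i) := by
    funext i
    fin_cases i <;> simp [hn₃, hn₂, hn₁]
  refine ⟨⟨rc, hrcd, hrci⟩, fun r hr hri => ?_⟩
  have h1 := hrel₁ r hr hri
  have h2 := hrel₂ r₁ hr₁d hr₁i
  have h3 := hrel₃ r₂ hr₂d hr₂i
  have h4 : KZ.of r - KZ.of r₃ ∈ KZ.relations :=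
    coneMain_reflect_equivalent Ql hQl Spx hSpx M₀ hM₀ n r r₃ hr hri (by rw [hr₃d, hn₃eq]) hr₃i
  refine ⟨![z₁, z₂, z₃], ![ε₁, -ε₂, ε₃], ?_, ?_, ?_⟩
  · intro i; fin_cases i <;> assumption
  · intro i; fin_cases i <;> assumption
  · rw [Fin.sum_univ_three]
    simp only [Matrix.cons_val_zero, Matrix.cons_val_one, Matrix.head_cons, Matrix.cons_val_two,
      Matrix.tail_cons, neg_smul]
    have key : 2 • KZ.of r - (ε₁ • KZ.of (ρ z₁) + -(ε₂ • KZ.of (ρ z₂)) + ε₃ • KZ.of (ρ z₃)) =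
        (-(KZ.of R₁ - KZ.of r - KZ.of r₁) + (KZ.of R₂ - KZ.of r₁ - KZ.of r₂) - (KZ.of R₃ - KZ.of r₂ - KZ.of r₃)
          + (KZ.of r - KZ.of r₃)) + (KZ.of R₁ - ε₁ • KZ.of (ρ z₁)) - (KZ.of R₂ - ε₂ • KZ.of (ρ z₂))
          + (KZ.of R₃ - ε₃ • KZ.of (ρ z₃)) := by
      abel
    rw [key]
    refine add_mem (sub_mem (add_mem ?_ hc₁) hc₂) hc₃
    exact add_mem (sub_mem (add_mem (neg_mem h1) h2) h3) h4


end Summit.KontsevichZagierPeriods.HyperbolicBloch.OffTetraSectorKernel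

end
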